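import Summits.RiemannHypothesis.RiemannHypothesis.Theorems.JensenPolynomialsSkewFarMoments

/-!
# Route `JensenPolynomials`, FAR crux `XiCumulantSkew98Far` — part 6b: the relative variance and the normalised third
cumulant of `U = u⁻²` as functions of the mode (RH-FREE; cell rh-jensen, HUMAN RULING D-0040)

With `M = m + 3 ≥ 2·10¹⁸`, `s = 2M`, `a = a_s ≥ 9.45` and the moments `m_j = M_{s−2j} = xiMoment (2m + 6 − 2j)`:
the relative variance `v = m₂m₀/m₁² − 1` of `U` under `ν_s` and the normalised third central moment
`κ₃ = (m₃m₀² − 3m₂m₁m₀ + 2m₁³)/m₁³` satisfy, in terms of `P, Q, T` of part 6a (`p = P/(aR)`),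

  `v = (Q − P²/R)/(a²R(1+p)²)`,   `κ₃ = (T − 3PQ + 2P³/R)/(a³R²(1+p)³)`   (exact algebra),

whence the INTERFACE of the Stein-moment line (`far_interface`):

  `1.99/(4a+1) ≤ M·v ≤ 2.01/(4a+1)`,   `0 ≤ (b−1)(b−2)κ₃ ≤ 0.07`   (`b = M − ½`).

(Theory g7's stub T2 `M·v ≥ 1/40` of LINE far-skew-moments is false for `M ≳ 10³⁶` — `M·v ≈ 2/(4a+1) → 0`; this
mode-dependent two-sided law replaces it.) WHAT THIS IS NOT: nothing here bears on the zeros of `ζ`.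
References: [GORZPNAS2019], [GriffinEtAl2022], HOME:eng-5/ET3.md §8 (structure of q).
-/

noncomputable section
-- D-0017: `Summit.RiemannHypothesis.RiemannHypothesis.…` duplicates the namespace BY DESIGN (single-problem summit).
set_option linter.dupNamespace false

namespace Summit.RiemannHypothesis.RiemannHypothesis.Theorems.JensenPolynomials.SkewFar

open Literature.NumberTheory.LFunctions Literature.Probability.Distributions MeasureTheory Set Filter Real
open scoped Topology Nat

/-! ## 1. Exact algebra: `v` and `κ₃` through `P, Q, T` -/

/-- `m₂m₀/m₁² − 1 = (Q − P²/R)/(a²R(1 + P/(aR))²)`. -/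
theorem relVar_eq_PQ {m₀ m₁ m₂ a R P Q : ℝ} (hm₀ : m₀ ≠ 0) (hm₁ : m₁ ≠ 0) (ha : a ≠ 0) (hR : R ≠ 0)
    (hP : P = a ^ 3 * R * (m₁ / m₀ - 1 / a ^ 2)) (hQ : Q = a ^ 6 * R * (m₂ / m₀ - 2 * m₁ / (a ^ 2 * m₀) + 1 / a ^ 4)) :
    m₂ * m₀ / m₁ ^ 2 - 1 = (Q - P ^ 2 / R) / (a ^ 2 * R * (1 + P / (a * R)) ^ 2) := by
  have h1 : 1 + P / (a * R) = a ^ 2 * (m₁ / m₀) := by rw [hP]; field_simp; ring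
  have hden : a ^ 2 * R * (1 + P / (a * R)) ^ 2 ≠ 0 := by
    rw [h1]; exact mul_ne_zero (mul_ne_zero (pow_ne_zero 2 ha) hR) (pow_ne_zero 2 (by positivity))
  rw [eq_div_iff hden, h1, hP, hQ]
  field_simp
  ring

/-- `(m₃m₀² − 3m₂m₁m₀ + 2m₁³)/m₁³ = (T − 3PQ + 2P³/R)/(a³R²(1 + P/(aR))³)`. -/
theorem kappa3_eq_PQT {m₀ m₁ m₂ m₃ a R P Q T : ℝ} (hm₀ : m₀ ≠ 0) (hm₁ : m₁ ≠ 0) (ha : a ≠ 0) (hR : R ≠ 0)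
    (hP : P = a ^ 3 * R * (m₁ / m₀ - 1 / a ^ 2)) (hQ : Q = a ^ 6 * R * (m₂ / m₀ - 2 * m₁ / (a ^ 2 * m₀) + 1 / a ^ 4))
    (hT : T = a ^ 9 * R ^ 2 * (m₃ / m₀ - 3 * m₂ / (a ^ 2 * m₀) + 3 * m₁ / (a ^ 4 * m₀) - 1 / a ^ 6)) :
    (m₃ * m₀ ^ 2 - 3 * m₂ * m₁ * m₀ + 2 * m₁ ^ 3) / m₁ ^ 3 =
      (T - 3 * P * Q + 2 * P ^ 3 / R) / (a ^ 3 * R ^ 2 * (1 + P / (a * R)) ^ 3) := by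
  have h1 : 1 + P / (a * R) = a ^ 2 * (m₁ / m₀) := by rw [hP]; field_simp; ring
  have hden : a ^ 3 * R ^ 2 * (1 + P / (a * R)) ^ 3 ≠ 0 := by
    rw [h1]; exact mul_ne_zero (mul_ne_zero (pow_ne_zero 3 ha) (pow_ne_zero 2 hR)) (pow_ne_zero 3 (by positivity))
  rw [div_eq_div_iff (pow_ne_zero 3 hm₁) hden, h1, hP, hQ, hT]
  field_simp
  ring

/-! ## 2. The interface of the Stein-moment line -/

/-- Final numeric step for `K ≤ 0.07`. -/
theorem aux_K {a κ : ℝ} (ha : 189 / 20 ≤ a) (hκ : κ ≤ 2) (hκ0 : 0 ≤ κ) :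
    a * (16.001 * κ + 72.01 / a + 0.34) ≤ 0.07 * (4 * (4 * a + 1) ^ 2 * (1 - 1e-17) ^ 3) := by
  have ha0 : 0 < a := by linarith
  have h72 : a * (16.001 * κ + 72.01 / a + 0.34) = 16.001 * (a * κ) + 72.01 + 0.34 * a := by
    field_simp
  rw [h72]
  have haκ : a * κ ≤ a * 2 := mul_le_mul_of_nonneg_left hκ ha0.le
  nlinarith

/-- Final numeric steps for the bounds on `M·v`. -/
theorem aux_v {a : ℝ} (ha : 189 / 20 ≤ a) :
    4.0001 * (4 * a + 1) ≤ 2.01 * (2 * (4 * a + 1) * (1 - 1e-17) ^ 2) ∧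
    1.99 * (2 * ((4 * a + 1) * (1 + 1e-15)) * (1 + 1e-17) ^ 2) ≤ 3.9998 * (4 * a + 1) := by
  constructor <;> nlinarith

set_option maxHeartbeats 1600000 in -- long interval bookkeeping in a large context, no search
/-- **Interface.** For `M = m + 3 ≥ 2·10¹⁸` there is `a ≥ 9.45` (the mode of `W_{2M}`) with
`1.99/(4a+1) ≤ M·v ≤ 2.01/(4a+1)` and `0 ≤ (M−3/2)(M−5/2)·κ₃ ≤ 0.07`, where `v`, `κ₃` are the relative variance and the
normalised third central moment of `u⁻²` under `ν_{2M}`, written through `xiMoment`. -/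
theorem far_interface (m : ℕ) (hm : 2 * 10 ^ 18 ≤ m + 3) :
    ∃ a : ℝ, 189 / 20 ≤ a ∧
      ((m : ℝ) + 3) * (xiMoment (2 * m + 2) * xiMoment (2 * m + 6) / xiMoment (2 * m + 4) ^ 2 - 1) ≤ 2.01 / (4 * a + 1) ∧
      1.99 / (4 * a + 1) ≤ ((m : ℝ) + 3) * (xiMoment (2 * m + 2) * xiMoment (2 * m + 6) / xiMoment (2 * m + 4) ^ 2 - 1) ∧
      0 ≤ ((m : ℝ) + 3 / 2) * ((m : ℝ) + 1 / 2) *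
        ((xiMoment (2 * m) * xiMoment (2 * m + 6) ^ 2 - 3 * xiMoment (2 * m + 2) * xiMoment (2 * m + 4) * xiMoment (2 * m + 6)
          + 2 * xiMoment (2 * m + 4) ^ 3) / xiMoment (2 * m + 4) ^ 3) ∧
      ((m : ℝ) + 3 / 2) * ((m : ℝ) + 1 / 2) *
        ((xiMoment (2 * m) * xiMoment (2 * m + 6) ^ 2 - 3 * xiMoment (2 * m + 2) * xiMoment (2 * m + 4) * xiMoment (2 * m + 6)
          + 2 * xiMoment (2 * m + 4) ^ 3) / xiMoment (2 * m + 4) ^ 3) ≤ 0.07 := by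
  set s : ℕ := 2 * m + 6 with hs_def
  have hs : 4 * 10 ^ 18 ≤ s := by omega
  have e2 : s - 2 = 2 * m + 4 := by omega
  have e4 : s - 4 = 2 * m + 2 := by omega
  have e6 : s - 6 = 2 * m := by omega
  obtain ⟨ha0, ha, _, _⟩ := mode_facts s hs
  obtain ⟨hApos, _, _, hR0, hc0, _, hRω1, hRω2⟩ :=
    consts_facts s hs (A := 4 * π * exp (4 * xiMode (s : ℝ))) (R := _) (c := _) rfl rfl rfl
  obtain ⟨_, _, _, hκ1, hκ2⟩ := const_sizes s hs (A := 4 * π * exp (4 * xiMode (s : ℝ))) (R := _) (c := _) rfl rfl rfl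
    (l := xiMode (s : ℝ) / Real.sqrt s) rfl
  have hRbig := R_large s hs (A := 4 * π * exp (4 * xiMode (s : ℝ))) (R := _) (c := _) rfl rfl rfl
  have hP := P_bound s hs (A := 4 * π * exp (4 * xiMode (s : ℝ))) (R := _) (c := _) (P := _) rfl rfl rfl rfl
  have hQ := Q_bound s hs (A := 4 * π * exp (4 * xiMode (s : ℝ))) (R := _) (c := _) (Q := _) rfl rfl rfl rfl
  have hT := T_bound s hs (A := 4 * π * exp (4 * xiMode (s : ℝ))) (R := _) (c := _) (T := _) rfl rfl rfl rfl
  have h6 := pow_six_le s hs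
  rw [e2] at hP hQ hT
  rw [e4] at hQ hT
  rw [e6] at hT
  set a := xiMode (s : ℝ) with ha_def
  set A := 4 * π * exp (4 * a) with hA
  set R := 4 * A + s / a ^ 2 with hR
  set c := 8 * A - s / a ^ 3 with hc
  set κ := c / R with hκ
  set m₀ := xiMoment s with hm₀
  set m₁ := xiMoment (2 * m + 4) with hm₁
  set m₂ := xiMoment (2 * m + 2) with hm₂
  set m₃ := xiMoment (2 * m) with hm₃
  set P := a ^ 3 * R * (m₁ / m₀ - 1 / a ^ 2) with hPdef
  set Q := a ^ 6 * R * (m₂ / m₀ - 2 * m₁ / (a ^ 2 * m₀) + 1 / a ^ 4) with hQdef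
  set T := a ^ 9 * R ^ 2 * (m₃ / m₀ - 3 * m₂ / (a ^ 2 * m₀) + 3 * m₁ / (a ^ 4 * m₀) - 1 / a ^ 6) with hTdef
  have hm0 : 0 < m₀ := xiMoment_pos _
  have hm1 : 0 < m₁ := xiMoment_pos _
  have hsR : ((s : ℕ) : ℝ) = 2 * ((m : ℝ) + 3) := by rw [hs_def]; push_cast; ring
  -- derived quantities
  have h3a : 3 / a ≤ 3 / (189 / 20) := div_le_div_of_nonneg_left (by norm_num) (by norm_num) ha
  have h3a0 : 0 < 3 / a := by positivity
  have hPabs : |P| ≤ 4.4 := by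
    have h := abs_le.1 hP
    rw [abs_le]; constructor <;> linarith [h.1, h.2]
  have hp : |P / (a * R)| ≤ 1e-17 := by
    rw [abs_div, abs_of_pos (mul_pos ha0 hR0), div_le_iff₀ (mul_pos ha0 hR0)]
    have haR : (189 / 20) * 1e17 ≤ a * R := mul_le_mul ha hRbig (by norm_num) ha0.le
    linarith
  obtain ⟨hp1, hp2⟩ := abs_le.1 hp
  set p := P / (a * R) with hpdef
  have h1p : 0 < 1 + p := by linarith
  have hV := relVar_eq_PQ hm0.ne' hm1.ne' ha0.ne' hR0.ne' hPdef hQdef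
  have hK := kappa3_eq_PQT hm0.ne' hm1.ne' ha0.ne' hR0.ne' hPdef hQdef hTdef
  rw [← hpdef] at hV hK
  have hs' : (4 * 10 ^ 18 : ℝ) ≤ (s : ℝ) := by exact_mod_cast hs
  have hspos : (0 : ℝ) < s := by linarith
  set W := R * a ^ 2 / s with hW
  have hW0 : 0 < W := by positivity
  have hW1 : 4 * a + 1 ≤ W := hRω1
  -- `a²/s ≤ 10⁻¹⁵`
  have has : a ^ 2 / (s : ℝ) ≤ 1e-15 := by
    rw [div_le_iff₀ hspos]
    have ha4 : (7974 : ℝ) ≤ a ^ 4 := by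
      have h := pow_le_pow_left₀ (by norm_num) ha 4; norm_num at h; linarith
    have h1 : 1000 * a ^ 2 ≤ a ^ 6 := by
      calc 1000 * a ^ 2 ≤ a ^ 4 * a ^ 2 := mul_le_mul_of_nonneg_right (by linarith) (sq_nonneg a)
        _ = a ^ 6 := by ring
    linarith
  have hW2 : W ≤ (4 * a + 1) * (1 + 1e-15) := by
    have h1 : W ≤ 4 * a + 1 + 37 * (a ^ 2 / s) := hRω2
    have e : (4 * a + 1) * (1 + 1e-15) = 4 * a + 1 + 1e-15 * (4 * a + 1) := by ring
    rw [e]; linarith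
  -- `(m+3)·v = (Q − P²/R)/(2W(1+p)²)`
  have hMv : ((m : ℝ) + 3) * (m₂ * m₀ / m₁ ^ 2 - 1) = (Q - P ^ 2 / R) / (2 * W * (1 + p) ^ 2) := by
    rw [hV, hW]
    have hm3 : (m : ℝ) + 3 = (s : ℝ) / 2 := by rw [hsR]; ring
    rw [hm3]
    field_simp
  have hP2R : 0 ≤ P ^ 2 / R := by positivity
  have hP2R' : P ^ 2 / R ≤ 2e-16 := by
    rw [div_le_iff₀ hR0]
    have hP2 : P ^ 2 ≤ 4.4 ^ 2 := by rw [← sq_abs]; exact pow_le_pow_left₀ (abs_nonneg _) hPabs 2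
    linarith
  obtain ⟨hQ1, hQ2⟩ := abs_le.1 hQ
  obtain ⟨hT1, hT2⟩ := abs_le.1 hT
  obtain ⟨hP1, hP2'⟩ := abs_le.1 hP
  have ha1 : 0 < 4 * a + 1 := by linarith
  -- `N = T − 3PQ + 2P³/R`
  have hPpos : 0 < P := by
    have : 3 / a > 0 := by positivity
    linarith
  have hPQ1 : (2 * κ + 3 / a - 0.011) * (4 - 1e-4) ≤ P * Q :=
    mul_le_mul (by linarith) (by linarith) (by norm_num) hPpos.le
  have hPQ2 : P * Q ≤ (2 * κ + 3 / a + 0.011) * (4 + 1e-4) :=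
    mul_le_mul (by linarith) (by linarith) (by linarith) (by linarith)
  have hP3 : 0 ≤ 2 * P ^ 3 / R := by positivity
  have hP3' : 2 * P ^ 3 / R ≤ 2e-15 := by
    rw [div_le_iff₀ hR0]
    have hP44 : P ≤ 4.4 := by linarith
    have : P ^ 3 ≤ 4.4 ^ 3 := pow_le_pow_left₀ hPpos.le hP44 3
    linarith
  have e108 : (108 : ℝ) / a = 36 * (3 / a) := by ring
  have e72a : (71.99 : ℝ) / a = 71.99 / 3 * (3 / a) := by ring
  have e72b : (72.01 : ℝ) / a = 72.01 / 3 * (3 / a) := by ring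
  rw [e108] at hT1 hT2
  have hN1 : 15.99 * κ + 71.99 / a - 0.34 ≤ T - 3 * P * Q + 2 * P ^ 3 / R := by
    rw [e72a]; linarith [hPQ2, hP3, hT1]
  have hN2 : T - 3 * P * Q + 2 * P ^ 3 / R ≤ 16.001 * κ + 72.01 / a + 0.34 := by
    rw [e72b]; linarith [hPQ1, hP3', hT2]
  have hNpos : 0 < T - 3 * P * Q + 2 * P ^ 3 / R := by linarith
  -- `(b−1)(b−2)κ₃ = ((s−3)(s−5)/s²)·(a/(4W²))·N/(1+p)³`
  have hKid : ((m : ℝ) + 3 / 2) * ((m : ℝ) + 1 / 2) * ((m₃ * m₀ ^ 2 - 3 * m₂ * m₁ * m₀ + 2 * m₁ ^ 3) / m₁ ^ 3) =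
      (((m : ℝ) + 3 / 2) * ((m : ℝ) + 1 / 2) / ((m : ℝ) + 3) ^ 2) * (a / (4 * W ^ 2)) *
        ((T - 3 * P * Q + 2 * P ^ 3 / R) / (1 + p) ^ 3) := by
    rw [hK, hW, hsR]
    field_simp
    ring
  have hfrac0 : 0 ≤ ((m : ℝ) + 3 / 2) * ((m : ℝ) + 1 / 2) / ((m : ℝ) + 3) ^ 2 := by positivity
  have hfrac1 : ((m : ℝ) + 3 / 2) * ((m : ℝ) + 1 / 2) / ((m : ℝ) + 3) ^ 2 ≤ 1 := by
    rw [div_le_one (by positivity)]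
    have hm0' : (0 : ℝ) ≤ m := Nat.cast_nonneg m
    have e : ((m : ℝ) + 3) ^ 2 - ((m : ℝ) + 3 / 2) * ((m : ℝ) + 1 / 2) = 4 * m + 33 / 4 := by ring
    linarith
  refine ⟨a, ha, ?_, ?_, ?_, ?_⟩
  · -- upper bound for `M·v`
    rw [hMv]
    have hden : 2 * (4 * a + 1) * (1 - 1e-17) ^ 2 ≤ 2 * W * (1 + p) ^ 2 := by
      have h1 : (1 - 1e-17) ^ 2 ≤ (1 + p) ^ 2 := pow_le_pow_left₀ (by norm_num) (by linarith only [hp1]) 2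
      exact mul_le_mul (by linarith only [hW1]) h1 (by positivity) (by positivity)
    calc (Q - P ^ 2 / R) / (2 * W * (1 + p) ^ 2) ≤ 4.0001 / (2 * (4 * a + 1) * (1 - 1e-17) ^ 2) :=
          div_le_div₀ (by norm_num) (by linarith only [hQ2, hP2R]) (by positivity) hden
      _ ≤ 2.01 / (4 * a + 1) := by
          rw [div_le_div_iff₀ (by positivity) ha1]
          exact (aux_v ha).1
  · -- lower bound for `M·v`
    rw [hMv]
    have hden : 2 * W * (1 + p) ^ 2 ≤ 2 * ((4 * a + 1) * (1 + 1e-15)) * (1 + 1e-17) ^ 2 := by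
      have h1 : (1 + p) ^ 2 ≤ (1 + 1e-17) ^ 2 := pow_le_pow_left₀ h1p.le (by linarith only [hp2]) 2
      exact mul_le_mul (by linarith only [hW2]) h1 (by positivity) (by positivity)
    calc 1.99 / (4 * a + 1) ≤ 3.9998 / (2 * ((4 * a + 1) * (1 + 1e-15)) * (1 + 1e-17) ^ 2) := by
          rw [div_le_div_iff₀ ha1 (by positivity)]
          exact (aux_v ha).2
      _ ≤ (Q - P ^ 2 / R) / (2 * W * (1 + p) ^ 2) :=
          div_le_div₀ (by linarith only [hQ1, hP2R']) (by linarith only [hQ1, hP2R']) (by positivity) hden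
  · -- `K ≥ 0`
    rw [hKid]
    positivity
  · -- `K ≤ 0.07`
    rw [hKid]
    have hp3 : (1 - 1e-17) ^ 3 ≤ (1 + p) ^ 3 := pow_le_pow_left₀ (by norm_num) (by linarith only [hp1]) 3
    have hW2sq : (4 * a + 1) ^ 2 ≤ W ^ 2 := pow_le_pow_left₀ ha1.le hW1 2
    have hmid : a / (4 * W ^ 2) ≤ a / (4 * (4 * a + 1) ^ 2) :=
      div_le_div_of_nonneg_left ha0.le (by positivity) (by linarith only [hW2sq])
    have hlast : (T - 3 * P * Q + 2 * P ^ 3 / R) / (1 + p) ^ 3 ≤ (16.001 * κ + 72.01 / a + 0.34) / (1 - 1e-17) ^ 3 :=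
      div_le_div₀ (by linarith only [hN2, hNpos]) hN2 (by norm_num) hp3
    have hprod := mul_le_mul (mul_le_mul hfrac1 hmid (by positivity) zero_le_one) hlast (by positivity)
      (by positivity)
    refine hprod.trans ?_
    rw [one_mul, div_mul_div_comm, div_le_iff₀ (by positivity)]
    exact aux_K ha hκ2 (by linarith only [hκ1])

end Summit.RiemannHypothesis.RiemannHypothesis.Theorems.JensenPolynomials.SkewFar

end
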